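/-
Copyright (c) 2026 the pub-hodgecm-mathlib formalisation cell (harness21).  Prover seat hodgecm-mathlib-K2-defs1 (g6), Track B, h413 = `stmt-HodgeConjecture-24833`, route `HCCMUnconditional`,
campaign «5Res (b) BL-2(χ,τ)», SHEET row 3 (dealer K2E1-plan (g6) (95) 2026-09-04T10:49:07Z «row 3 → K2-defs1 GO»).
-/
import Summits.HodgeConjecture.HodgeConjecture.Theorems.K2E1CharacterEisensteinU2Defs     -- ★ p859441 (this seat): `IsChiSection`, `firstEntryUnit`, `reflectChar`, `HasReflectedIntertwining`
import Summits.HodgeConjecture.HodgeConjecture.Theorems.K2E1IntertwiningGrowthU2          -- ★ `borelHeight_weylLongU_mul_diag_mul`, `norm_intertwinedCoeff_le`; brings ★ `map_torusConj_eq_torusRootModulus_smul_two`, `integral_weyl_mul_unipotent_mul_two`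
import HarnessLib

/-!
# 5Res (b) row 3 — `K2E1ChiIntertwinedSectionU2`: THE INTERTWINED SECTION `M(z, χ)φ` OF `U(1,1)` IS A `χʷ`-SECTION — `g ↦ (∫_{N(𝔸)} f_z(w₀ v g) dν(v))·H(g)^{z−1}` satisfies
# `IsChiSection (reflectChar c χ) ·`, hence `HasReflectedIntertwining χ ν φ φ′ z` holds with this `φ′` (every `z`; no convergence hypothesis, no Euler product, no L-function)

Cell `pub/hodgecm-mathlib`, crux H413 = `stmt-HodgeConjecture-24833`.  THEOREMS ONLY (no `def`, no `instance`, no notation, no named-fact hypothesis, no `sorry`); lane `--supports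
stmt-HodgeConjecture-24833 --as helper` (count-neutral).  Closes no socket.  Generic quadratic datum `(F, E, c)` with `c² = 1`, `c ≠ 1`, `N = 2`.

THE MATHEMATICS ([MoeglinWaldspurger1995, II.1.6–II.1.7]; [GelbartRogawski1991, §3.1]; [Garrett2018, §2.8]).  `W = ι(w₀)` (★ `weylLongU`, matrix `Φ₂ = antidiag(1,1)`), `f_z = φ·H^z` the flat
section of a `χ`-section `φ` (`φ(b g) = χ(b₀₀)φ(g)`, ★ `IsChiSection`), `φ̃(g) := (∫_{N(𝔸)} f_z(W v g) dν(v))·H(g)^{z−1}` (the ★ spherical files' INLINE «intertwined coefficient», so that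
`φ̃·H^{1−z} = M(w₀)f_z` by ★ `flatSectionU_intertwinedCoeff_two`).  (§1) `W·diag(d₀,d₁)·W⁻¹ = diag(d₁,d₀)` in `U(J₂)(𝔸_F)`, and on the torus `c(d₀)·d₁ = 1` (★ `torus_relations_two`), so
`χ(d₁) = χ(c d₀)⁻¹ = χʷ(d₀)` (★ `reflectChar`).  (§2) Hence for `t = diag(d)`: `f_z(W t y) = χʷ(d₀)·‖d₀‖^{−z}·f_z(W y)` (★ `borelHeight_weylLongU_mul_diag_mul`), and, substituting
`v = t u t⁻¹` (★ `map_torusConj_eq_torusRootModulus_smul_two`: `δ_B(t) = ‖d₀‖`), `∫ f_z(W v t x) dν = χʷ(d₀)·‖d₀‖^{1−z}·∫ f_z(W v x) dν`.  (§3) With the Levi decomposition `b = t n` (★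
`torusPart`), `N(𝔸)`-invariance (★ `integral_weyl_mul_unipotent_mul_two`) and `H(b g) = ‖d₀‖·H(g)` (★ `distribHaarChar_torus_two`): `φ̃(b g) = χʷ(b₀₀)·φ̃(g)` — **`φ̃` IS A `χʷ`-SECTION** —
and `HasReflectedIntertwining χ ν φ φ̃ z` (★ p859441 §4) holds for EVERY `z` (both sides carry the same Bochner junk off the half-plane of convergence); the bound `‖φ̃‖ ≤ C_φ·c(Re z)` on
`1 < Re z` is ★ `norm_intertwinedCoeff_le` (general `φ`) verbatim.  This is «`M(z,χ)φ` exists and lies in `I(χʷ, 1−z)`» of SHEET row 3, L-function-free.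
* §1 `adelicVal_weylLongU_apply`, `glDiagonal_rev_eq_adelicVal_weylConj` (`W t W⁻¹ = diag(d ∘ rev)`), `torus_snd_eq_conj_fst_inv` (`d₁ = (c d₀)⁻¹`), `chi_torus_snd_eq_reflectChar`.
* §2 `apply_weylLongU_torus_mul_of_isChiSection`, `flatSectionU_weylLongU_torus_mul_of_isChiSection`, `integral_flatSectionU_weylLongU_torus_mul_of_isChiSection`.
* §3 HEADS **`isChiSection_intertwinedCoeff_two`**, **`hasReflectedIntertwining_intertwinedCoeff_two`**.
HONEST LABEL: HC_CM is proved only modulo the 7 printed citations (2 remaining named inputs: hLiu418 = `stmt-HodgeConjecture-24832`, h413 = `stmt-HodgeConjecture-24833`) until rung 0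
closes; count-neutral helper, closes no socket.

## References
* [MoeglinWaldspurger1995] C. Mœglin, J.-L. Waldspurger, *Spectral decomposition and Eisenstein series* (1995), II.1.6 (the intertwining operator `M(w, π)`), II.1.7 (constant terms of Eisenstein series).
* [GelbartRogawski1991] S. Gelbart, J. Rogawski, *L-functions and Fourier–Jacobi coefficients for the unitary group U(3)*, Invent. Math. 105 (1991), §3.1.
* [Garrett2018] P. Garrett, *Modern Analysis of Automorphic Forms by Example* 1 (2018), §2.8 (the intertwining integral and its torus equivariance).
-/

set_option autoImplicit false
-- the mandated namespace repeats the single-problem summit's segment (`HodgeConjecture.HodgeConjecture`)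
set_option linter.dupNamespace false

noncomputable section

open MeasureTheory Measure NumberField IsDedekindDomain Matrix
open scoped ENNReal NNReal MatrixGroups
open Literature.NumberTheory Literature.NumberTheory.Automorphic Literature.NumberTheory.Automorphic.UnitaryGroup AdelicGroupData
open Literature.NumberTheory.GaloisRepresentations (HeckeCharacter ideleGroup)
open Summit.HodgeConjecture.HodgeConjecture.Cruxes.H413.K2E1BorelEisensteinU
open Summit.HodgeConjecture.HodgeConjecture.Cruxes.H413.K2E1CharacterEisensteinU2Defs
open Summit.HodgeConjecture.HodgeConjecture.Cruxes.H413.K2E1IntertwinedSectionInvariance (integral_weyl_mul_unipotent_mul_two)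
open Summit.HodgeConjecture.HodgeConjecture.Cruxes.H413.K2E1MaassSelbergBracketsThree (measurable_flatSectionU)
open Summit.HodgeConjecture.HodgeConjecture.Cruxes.H413.K2E1IntertwiningGrowthU2 (borelHeight_weylLongU_mul_diag_mul)
open Summit.HodgeConjecture.HodgeConjecture.Cruxes.H413.K2E1MaassSelbergCMTwoConstantTerms (flatSectionU_intertwinedCoeff_two)

namespace Summit.HodgeConjecture.HodgeConjecture.Cruxes.H413.K2E1ChiIntertwinedSectionU2

variable {F E : Type} [Field F] [NumberField F] [Field E] [NumberField E] [Algebra F E] {c : E ≃ₐ[F] E}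

/-! ## §1 `W·diag(d₀,d₁)·W⁻¹ = diag(d₁,d₀)` and `χ(d₁) = χʷ(d₀)` on the torus of `U(J₂)` -/

/-- The adelic matrix of `W = ι(w₀)` is `Φ₂`: `W i k = [k = rev i]` (★ `coe_coe_weylLongU`, ★ `StdForm.antidiagonal_over_apply`). [cite: MoeglinWaldspurger1995, I.2.2] -/
theorem adelicVal_weylLongU_apply (i k : Fin 2) :
    (adelicVal F E c 2 _ ((quasiSplit F E c 2).toAdelic (weylLongU (c : E →+* E) (rfl : (StdForm.antidiagonal 2).over E = (StdForm.antidiagonal 2).over E))) : Matrix (Fin 2) (Fin 2) (AdeleRing (𝓞 E) E)) i k =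
      if k = i.rev then 1 else 0 := by
  change algebraMap E (AdeleRing (𝓞 E) E)
      ((((weylLongU (c : E →+* E) (rfl : (StdForm.antidiagonal 2).over E = (StdForm.antidiagonal 2).over E) :
        ↥(unitaryGroupOfForm (c : E →+* E) ((StdForm.antidiagonal 2).over E))) : GL (Fin 2) E) : Matrix (Fin 2) (Fin 2) E) i k) = _
  rw [coe_coe_weylLongU, StdForm.antidiagonal_over_apply]
  split_ifs <;> simp

/-- **`W·t·W⁻¹ = diag(d ∘ rev)`** for `t = diag(d) ∈ T(𝔸_F)`: conjugation by the long Weyl element reverses the diagonal (so `W t W⁻¹ ∈ T(𝔸_F) ≤ B(𝔸_F)` with first entry `d₁`).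
[cite: MoeglinWaldspurger1995, II.1.7] -/
theorem glDiagonal_rev_eq_adelicVal_weylConj {t : (quasiSplit F E c 2).Adelic} {d : Fin 2 → (AdeleRing (𝓞 E) E)ˣ} (hd : glDiagonal 2 (AdeleRing (𝓞 E) E) d = adelicVal F E c 2 _ t) :
    glDiagonal 2 (AdeleRing (𝓞 E) E) (d ∘ Fin.rev) =
      adelicVal F E c 2 _ ((quasiSplit F E c 2).toAdelic (weylLongU (c : E →+* E) (rfl : (StdForm.antidiagonal 2).over E = (StdForm.antidiagonal 2).over E)) * t *
        ((quasiSplit F E c 2).toAdelic (weylLongU (c : E →+* E) (rfl : (StdForm.antidiagonal 2).over E = (StdForm.antidiagonal 2).over E)))⁻¹) := by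
  rw [map_mul, map_inv, map_mul, ← hd, eq_mul_inv_iff_mul_eq]
  refine Units.ext (Matrix.ext fun i j => ?_)
  rw [Units.val_mul, Units.val_mul, coe_glDiagonal, coe_glDiagonal, Matrix.mul_apply, Matrix.mul_apply, Fin.sum_univ_two, Fin.sum_univ_two]
  simp only [Matrix.diagonal_apply, adelicVal_weylLongU_apply, Function.comp_apply]
  fin_cases i <;> fin_cases j <;> simp [Fin.rev]

/-- **On the torus of `U(J₂)`, `d₁ = (c d₀)⁻¹`** as ideles (★ `torus_relations_two`: `c(d₀)·d₁ = 1`). [cite: Rogawski1990, §1.10] -/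
theorem torus_snd_eq_conj_fst_inv (t : ↥(torusInBorel F E c 2)) {d : Fin 2 → (AdeleRing (𝓞 E) E)ˣ}
    (hd : glDiagonal 2 (AdeleRing (𝓞 E) E) d = adelicVal F E c 2 _ ((t : borelAdelic F E c 2) : (quasiSplit F E c 2).Adelic)) :
    d 1 = (Units.map (conjAdele F E c : AdeleRing (𝓞 E) E →+* AdeleRing (𝓞 E) E).toMonoidHom (d 0))⁻¹ := by
  obtain ⟨-, h01⟩ := torus_relations_two t hd
  have hu : Units.map (conjAdele F E c : AdeleRing (𝓞 E) E →+* AdeleRing (𝓞 E) E).toMonoidHom (d 0) * d 1 = 1 :=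
    Units.ext (by rw [Units.val_mul, Units.coe_map, Units.val_one]; exact h01)
  exact eq_inv_of_mul_eq_one_right hu

/-- **`χ(d₁) = χʷ(d₀)`** on the torus of `U(J₂)` (`χʷ = reflectChar c χ`, `χʷ(a) = χ(c a)⁻¹`). [cite: MoeglinWaldspurger1995, II.1.7] -/
theorem chi_torus_snd_eq_reflectChar (χ : HeckeCharacter E) (t : ↥(torusInBorel F E c 2)) {d : Fin 2 → (AdeleRing (𝓞 E) E)ˣ}
    (hd : glDiagonal 2 (AdeleRing (𝓞 E) E) d = adelicVal F E c 2 _ ((t : borelAdelic F E c 2) : (quasiSplit F E c 2).Adelic)) :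
    χ (d 1) = reflectChar c χ (d 0) := by
  rw [torus_snd_eq_conj_fst_inv t hd, map_inv, reflectChar_apply]

/-! ## §2 The flat section and the intertwining integral under `W` and the torus -/

section Scaling

variable [MeasurableSpace (quasiSplit F E c 2).Adelic] [BorelSpace (quasiSplit F E c 2).Adelic]

omit [MeasurableSpace (quasiSplit F E c 2).Adelic] [BorelSpace (quasiSplit F E c 2).Adelic] in
/-- **`φ(W t y) = χ(d₁)·φ(W y)`** for a `χ`-section `φ` and `t = diag(d) ∈ T(𝔸_F)` (`W t = (W t W⁻¹) W`, §1). [cite: MoeglinWaldspurger1995, II.1.6] -/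
theorem apply_weylLongU_torus_mul_of_isChiSection {χ : HeckeCharacter E} {φ : (quasiSplit F E c 2).Adelic → ℂ} (hφ : IsChiSection χ φ)
    (t : ↥(torusInBorel F E c 2)) {d : Fin 2 → (AdeleRing (𝓞 E) E)ˣ}
    (hd : glDiagonal 2 (AdeleRing (𝓞 E) E) d = adelicVal F E c 2 _ ((t : borelAdelic F E c 2) : (quasiSplit F E c 2).Adelic)) (y : (quasiSplit F E c 2).Adelic) :
    φ ((quasiSplit F E c 2).toAdelic (weylLongU (c : E →+* E) (rfl : (StdForm.antidiagonal 2).over E = (StdForm.antidiagonal 2).over E)) * (((t : borelAdelic F E c 2) : (quasiSplit F E c 2).Adelic) * y)) =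
      ((χ (d 1) : ℂˣ) : ℂ) * φ ((quasiSplit F E c 2).toAdelic (weylLongU (c : E →+* E) (rfl : (StdForm.antidiagonal 2).over E = (StdForm.antidiagonal 2).over E)) * y) := by
  set W : (quasiSplit F E c 2).Adelic := (quasiSplit F E c 2).toAdelic (weylLongU (c : E →+* E) (rfl : (StdForm.antidiagonal 2).over E = (StdForm.antidiagonal 2).over E)) with hW
  set T : (quasiSplit F E c 2).Adelic := ((t : borelAdelic F E c 2) : (quasiSplit F E c 2).Adelic) with hT
  have hd' := glDiagonal_rev_eq_adelicVal_weylConj hd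
  have hB : W * T * W⁻¹ ∈ borelAdelic F E c 2 := torusAdelic_le_borelAdelic ⟨d ∘ Fin.rev, hd'⟩
  have h0 : firstEntryUnit hB = d 1 := by
    refine Units.ext ?_
    rw [coe_firstEntryUnit, ← hd', coe_glDiagonal, Matrix.diagonal_apply_eq]
    rfl
  rw [show W * (T * y) = (W * T * W⁻¹) * (W * y) by group, hφ.borel_mul hB, h0]

omit [MeasurableSpace (quasiSplit F E c 2).Adelic] [BorelSpace (quasiSplit F E c 2).Adelic] in
/-- **`f_z(W t y) = χ(d₁)·‖d₀‖_𝔸^{−z}… precisely `χ(d₁)·((‖d₀‖⁻¹ : ℝ) : ℂ)^z·f_z(W y)`** (`H(W t y) = ‖d₀‖⁻¹ H(W y)`, ★ `borelHeight_weylLongU_mul_diag_mul`). [cite: MoeglinWaldspurger1995, II.1.6] -/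
theorem flatSectionU_weylLongU_torus_mul_of_isChiSection {χ : HeckeCharacter E} {φ : (quasiSplit F E c 2).Adelic → ℂ} (hφ : IsChiSection χ φ)
    (t : ↥(torusInBorel F E c 2)) {d : Fin 2 → (AdeleRing (𝓞 E) E)ˣ}
    (hd : glDiagonal 2 (AdeleRing (𝓞 E) E) d = adelicVal F E c 2 _ ((t : borelAdelic F E c 2) : (quasiSplit F E c 2).Adelic)) (z : ℂ) (y : (quasiSplit F E c 2).Adelic) :
    flatSectionU φ z ((quasiSplit F E c 2).toAdelic (weylLongU (c : E →+* E) (rfl : (StdForm.antidiagonal 2).over E = (StdForm.antidiagonal 2).over E)) * (((t : borelAdelic F E c 2) : (quasiSplit F E c 2).Adelic) * y)) =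
      ((χ (d 1) : ℂˣ) : ℂ) * ((((IdeleClassGroup.ideleNorm E (d 0))⁻¹ : ℝ≥0) : ℝ) : ℂ) ^ z *
        flatSectionU φ z ((quasiSplit F E c 2).toAdelic (weylLongU (c : E →+* E) (rfl : (StdForm.antidiagonal 2).over E = (StdForm.antidiagonal 2).over E)) * y) := by
  rw [flatSectionU_apply, flatSectionU_apply, apply_weylLongU_torus_mul_of_isChiSection hφ t hd y, borelHeight_weylLongU_mul_diag_mul hd, NNReal.coe_mul, Complex.ofReal_mul,
    Complex.mul_cpow_ofReal_nonneg (NNReal.coe_nonneg _) (NNReal.coe_nonneg _)]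
  ring

/-- **TORUS SCALING OF THE INTERTWINING INTEGRAL OF A `χ`-SECTION**: `∫ f_z(W v t x) dν(v) = δ_B(t)·χ(d₁)·(‖d₀‖⁻¹)^z·∫ f_z(W v x) dν(v)`, `δ_B(t) = torusRootModulus E 2 d` (substitute
`v = t u t⁻¹`, ★ `map_torusConj_eq_torusRootModulus_smul_two`, then the previous lemma pointwise).  No convergence hypothesis. [cite: MoeglinWaldspurger1995, II.1.6] [cite: Garrett2018, §2.8] -/
theorem integral_flatSectionU_weylLongU_torus_mul_of_isChiSection (hc : c * c = 1) (hc1 : c ≠ 1) (ν : Measure ↥(adelicUnipotent F E c 2)) [ν.IsHaarMeasure]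
    {χ : HeckeCharacter E} {φ : (quasiSplit F E c 2).Adelic → ℂ} (hφ : IsChiSection χ φ) (hφm : Measurable φ)
    (t : ↥(torusInBorel F E c 2)) {d : Fin 2 → (AdeleRing (𝓞 E) E)ˣ}
    (hd : glDiagonal 2 (AdeleRing (𝓞 E) E) d = adelicVal F E c 2 _ ((t : borelAdelic F E c 2) : (quasiSplit F E c 2).Adelic)) (z : ℂ) (x : (quasiSplit F E c 2).Adelic) :
    ∫ v : ↥(adelicUnipotent F E c 2), flatSectionU φ z ((quasiSplit F E c 2).toAdelic (weylLongU (c : E →+* E) (rfl : (StdForm.antidiagonal 2).over E = (StdForm.antidiagonal 2).over E)) *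
        ((v : (quasiSplit F E c 2).Adelic) * (((t : borelAdelic F E c 2) : (quasiSplit F E c 2).Adelic) * x))) ∂ν =
      ((torusRootModulus E 2 d : ℝ) : ℂ) * (((χ (d 1) : ℂˣ) : ℂ) * ((((IdeleClassGroup.ideleNorm E (d 0))⁻¹ : ℝ≥0) : ℝ) : ℂ) ^ z) *
        ∫ v : ↥(adelicUnipotent F E c 2), flatSectionU φ z ((quasiSplit F E c 2).toAdelic (weylLongU (c : E →+* E) (rfl : (StdForm.antidiagonal 2).over E = (StdForm.antidiagonal 2).over E)) *
          ((v : (quasiSplit F E c 2).Adelic) * x)) ∂ν := by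
  haveI := locallyCompactSpace_adeleRing' E
  letI : MeasurableSpace (AdeleRing (𝓞 E) E) := borel _
  haveI : BorelSpace (AdeleRing (𝓞 E) E) := ⟨rfl⟩
  set T : (quasiSplit F E c 2).Adelic := ((t : borelAdelic F E c 2) : (quasiSplit F E c 2).Adelic) with hT
  set W : (quasiSplit F E c 2).Adelic := (quasiSplit F E c 2).toAdelic (weylLongU (c : E →+* E) (rfl : (StdForm.antidiagonal 2).over E = (StdForm.antidiagonal 2).over E)) with hW
  -- the integrand as a function of `u = t⁻¹ v t`
  set Φ : ↥(adelicUnipotent F E c 2) → ℂ := fun u => flatSectionU φ z (W * (T * ((u : (quasiSplit F E c 2).Adelic) * x))) with hΦ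
  have hΦm : Measurable Φ :=
    (measurable_flatSectionU hφm z).comp (continuous_const.mul (continuous_const.mul (continuous_subtype_val.mul continuous_const))).measurable
  have hκ : Measurable fun u : ↥(adelicUnipotent F E c 2) => (⟨T⁻¹ * (u : (quasiSplit F E c 2).Adelic) * T,
      conj_mem_adelicUnipotent (t : borelAdelic F E c 2).2 u.2⟩ : ↥(adelicUnipotent F E c 2)) :=
    ((continuous_const.mul continuous_subtype_val).mul continuous_const).measurable.subtype_mk
  have h1 : (fun v : ↥(adelicUnipotent F E c 2) => flatSectionU φ z (W * ((v : (quasiSplit F E c 2).Adelic) * (T * x)))) =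
      fun v : ↥(adelicUnipotent F E c 2) => Φ (⟨T⁻¹ * (v : (quasiSplit F E c 2).Adelic) * T, conj_mem_adelicUnipotent (t : borelAdelic F E c 2).2 v.2⟩ : ↥(adelicUnipotent F E c 2)) := by
    funext v
    simp only [hΦ]
    rw [show T * (T⁻¹ * (v : (quasiSplit F E c 2).Adelic) * T * x) = (v : (quasiSplit F E c 2).Adelic) * (T * x) by group]
  have h2 : ∀ u : ↥(adelicUnipotent F E c 2), Φ u = (((χ (d 1) : ℂˣ) : ℂ) * ((((IdeleClassGroup.ideleNorm E (d 0))⁻¹ : ℝ≥0) : ℝ) : ℂ) ^ z) *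
      flatSectionU φ z (W * ((u : (quasiSplit F E c 2).Adelic) * x)) := fun u => by
    simp only [hΦ]
    rw [flatSectionU_weylLongU_torus_mul_of_isChiSection hφ t hd z]
  rw [h1, ← integral_map hκ.aemeasurable hΦm.aestronglyMeasurable, map_torusConj_eq_torusRootModulus_smul_two hc hc1 ν t hd, integral_smul_measure, ENNReal.coe_toReal]
  simp_rw [h2]
  rw [integral_const_mul, Complex.real_smul]
  ring

/-! ## §3 HEADS: the intertwined coefficient `φ̃ = (M(w₀) f_z)·H^{z−1}` is a `χʷ`-section; `HasReflectedIntertwining χ ν φ φ̃ z` -/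

/-- **ROW 3 HEAD — `M(z, χ)φ` IS A `χʷ`-SECTION**: for a Borel `χ`-section `φ` of `U(J₂)` (`c² = 1`, `c ≠ 1`) and ANY `z`, the intertwined coefficient
`φ̃(g) := (∫_{N(𝔸)} f_z(W v g) dν(v))·H(g)^{z−1}` satisfies `φ̃(b g) = χʷ(b₀₀)·φ̃(g)` for every `b ∈ B(𝔸_F)`, `χʷ = reflectChar c χ` — Levi `b = t n` (★ `torusPart`), `N(𝔸)`-invariance (★
`integral_weyl_mul_unipotent_mul_two`), §2 torus scaling with `δ_B(t) = ‖d₀‖` (★ `torusRootModulus_two_eq`), `H(b g) = ‖d₁‖⁻¹H(g) = ‖d₀‖H(g)` (★ `distribHaarChar_torus_two`), and the exponents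
`‖d₀‖^{1−z}·‖d₀‖^{z−1} = 1`.  Its sup bound `‖φ̃‖ ≤ C_φ·c(Re z)` on the half-plane is ★ `norm_intertwinedCoeff_le` (general `φ`). [cite: MoeglinWaldspurger1995, II.1.6–II.1.7] [cite: Garrett2018, §2.8] -/
theorem isChiSection_intertwinedCoeff_two (hc : c * c = 1) (hc1 : c ≠ 1) (ν : Measure ↥(adelicUnipotent F E c 2)) [ν.IsHaarMeasure]
    {χ : HeckeCharacter E} {φ : (quasiSplit F E c 2).Adelic → ℂ} (hφ : IsChiSection χ φ) (hφm : Measurable φ) (z : ℂ) :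
    IsChiSection (reflectChar c χ) (fun g : (quasiSplit F E c 2).Adelic =>
      (∫ v : ↥(adelicUnipotent F E c 2), flatSectionU φ z ((quasiSplit F E c 2).toAdelic (weylLongU (c : E →+* E) (rfl : (StdForm.antidiagonal 2).over E = (StdForm.antidiagonal 2).over E)) *
        ((v : (quasiSplit F E c 2).Adelic) * g)) ∂ν) * (((borelHeight g : ℝ) : ℂ) ^ (z - 1))) := by
  haveI := locallyCompactSpace_adeleRing' E
  intro b hb g
  dsimp only
  -- Levi `b = t n`
  set tB : ↥(torusInBorel F E c 2) := ⟨torusPart ⟨b, hb⟩, (mem_torusInBorel_iff _).2 (torusPart_mem_torusAdelic _)⟩ with htB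
  have hd : glDiagonal 2 (AdeleRing (𝓞 E) E) (diagUnit hb) = adelicVal F E c 2 _ ((tB : borelAdelic F E c 2) : (quasiSplit F E c 2).Adelic) := (adelicVal_torusPart ⟨b, hb⟩).symm
  have hn : (((tB : borelAdelic F E c 2) : (quasiSplit F E c 2).Adelic))⁻¹ * b ∈ adelicUnipotent F E c 2 := torusPart_inv_mul_mem_adelicUnipotent ⟨b, hb⟩
  have hbg : b * g = ((tB : borelAdelic F E c 2) : (quasiSplit F E c 2).Adelic) * (((((tB : borelAdelic F E c 2) : (quasiSplit F E c 2).Adelic))⁻¹ * b) * g) := by group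
  -- the integral: torus scaling, then `N(𝔸)`-invariance
  have hI : ∫ v : ↥(adelicUnipotent F E c 2), flatSectionU φ z ((quasiSplit F E c 2).toAdelic (weylLongU (c : E →+* E) (rfl : (StdForm.antidiagonal 2).over E = (StdForm.antidiagonal 2).over E)) *
        ((v : (quasiSplit F E c 2).Adelic) * (b * g))) ∂ν =
      ((torusRootModulus E 2 (diagUnit hb) : ℝ) : ℂ) * (((χ (diagUnit hb 1) : ℂˣ) : ℂ) * ((((IdeleClassGroup.ideleNorm E (diagUnit hb 0))⁻¹ : ℝ≥0) : ℝ) : ℂ) ^ z) *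
        ∫ v : ↥(adelicUnipotent F E c 2), flatSectionU φ z ((quasiSplit F E c 2).toAdelic (weylLongU (c : E →+* E) (rfl : (StdForm.antidiagonal 2).over E = (StdForm.antidiagonal 2).over E)) *
          ((v : (quasiSplit F E c 2).Adelic) * g)) ∂ν := by
    rw [hbg, integral_flatSectionU_weylLongU_torus_mul_of_isChiSection hc hc1 ν hφ hφm tB hd z]
    have key := integral_weyl_mul_unipotent_mul_two ν (flatSectionU φ z) hn g
    simp_rw [mul_assoc] at key ⊢
    rw [key]
  -- the height: `H(b g) = ‖d₀‖ · H(g)`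
  have hδ : (torusRootModulus E 2 (diagUnit hb) : ℝ) = (IdeleClassGroup.ideleNorm E (diagUnit hb 0) : ℝ) := by
    rw [torusRootModulus_two_eq tB hd, AdeleRing.distribHaarChar_eq_ideleNorm]
  have hHb : borelHeight (b * g) = IdeleClassGroup.ideleNorm E (diagUnit hb 0) * borelHeight g := by
    have h2 := distribHaarChar_torus_two tB hd
    rw [AdeleRing.distribHaarChar_eq_ideleNorm, AdeleRing.distribHaarChar_eq_ideleNorm] at h2
    have hlast : lastEntryUnit hb = diagUnit hb 1 := Units.ext rfl
    rw [borelHeight_borel_mul hb, hlast, h2, inv_inv]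
  -- the character: `χ(d₁) = χʷ(d₀)`, `d₀ = b₀₀`
  have hχ : χ (diagUnit hb 1) = reflectChar c χ (firstEntryUnit hb) := by
    rw [chi_torus_snd_eq_reflectChar χ tB hd]
    rfl
  rw [hI, hδ, hHb, hχ]
  -- exponents: `‖d₀‖ · (‖d₀‖⁻¹)^z · (‖d₀‖ H)^{z−1} = H^{z−1}`
  have hpos : (0 : ℝ) < (IdeleClassGroup.ideleNorm E (diagUnit hb 0) : ℝ) := ideleNorm_real_pos _
  have hH : (0 : ℝ) < (borelHeight g : ℝ) := by exact_mod_cast borelHeight_pos g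
  have hne : ((IdeleClassGroup.ideleNorm E (diagUnit hb 0) : ℝ) : ℂ) ≠ 0 := Complex.ofReal_ne_zero.2 hpos.ne'
  have harg : (((IdeleClassGroup.ideleNorm E (diagUnit hb 0) : ℝ) : ℂ)).arg ≠ Real.pi := by
    rw [Complex.arg_ofReal_of_nonneg hpos.le]; exact Real.pi_ne_zero.symm
  rw [NNReal.coe_mul, Complex.ofReal_mul, Complex.mul_cpow_ofReal_nonneg hpos.le hH.le, NNReal.coe_inv, Complex.ofReal_inv, Complex.inv_cpow _ _ harg]
  have hzz : ((IdeleClassGroup.ideleNorm E (diagUnit hb 0) : ℝ) : ℂ) ^ z ≠ 0 := by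
    rw [Ne, Complex.cpow_eq_zero_iff]; exact fun h => hne h.1
  have hsplit : ((IdeleClassGroup.ideleNorm E (diagUnit hb 0) : ℝ) : ℂ) ^ (z - 1) = ((IdeleClassGroup.ideleNorm E (diagUnit hb 0) : ℝ) : ℂ) ^ z * (((IdeleClassGroup.ideleNorm E (diagUnit hb 0) : ℝ) : ℂ))⁻¹ := by
    rw [Complex.cpow_sub _ _ hne, Complex.cpow_one, div_eq_mul_inv]
  rw [hsplit]
  field_simp

/-- **ROW 3 HEAD — `HasReflectedIntertwining χ ν φ φ̃ z` HOLDS** with `φ̃ := (M(w₀) f_z)·H^{z−1}` (★ p859441 §4's statement-only shape, now inhabited): `φ̃` is a `χʷ`-section (previous theorem)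
and `∫ f_z(W v g) dν = flatSectionU φ̃ (1 − z) g` (★ `flatSectionU_intertwinedCoeff_two`, `H^{z−1}·H^{1−z} = 1`).  Every `z`; the half-plane `1 < Re z` only enters the bound ★
`norm_intertwinedCoeff_le`. [cite: MoeglinWaldspurger1995, II.1.7] -/
theorem hasReflectedIntertwining_intertwinedCoeff_two (hc : c * c = 1) (hc1 : c ≠ 1) (ν : Measure ↥(adelicUnipotent F E c 2)) [ν.IsHaarMeasure]
    {χ : HeckeCharacter E} {φ : (quasiSplit F E c 2).Adelic → ℂ} (hφ : IsChiSection χ φ) (hφm : Measurable φ) (z : ℂ) :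
    HasReflectedIntertwining χ ν φ (fun g : (quasiSplit F E c 2).Adelic =>
      (∫ v : ↥(adelicUnipotent F E c 2), flatSectionU φ z ((quasiSplit F E c 2).toAdelic (weylLongU (c : E →+* E) (rfl : (StdForm.antidiagonal 2).over E = (StdForm.antidiagonal 2).over E)) *
        ((v : (quasiSplit F E c 2).Adelic) * g)) ∂ν) * (((borelHeight g : ℝ) : ℂ) ^ (z - 1))) z := by
  refine ⟨isChiSection_intertwinedCoeff_two hc hc1 ν hφ hφm z, fun g => ?_⟩
  rw [flatSectionU_intertwinedCoeff_two ν φ z g]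
  simp_rw [mul_assoc]

end Scaling

end Summit.HodgeConjecture.HodgeConjecture.Cruxes.H413.K2E1ChiIntertwinedSectionU2
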